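import Literature.AlgebraicGeometry.HodgeTheory.RibetTypeOnePowersHodgeClasses
import Literature.AlgebraicGeometry.HodgeTheory.WeilTypeHodgeGroupSemisimpleOfCentre
import Literature.AlgebraicGeometry.Motives.HodgeLieEigenspaceNoInvariantForm
import HarnessLib

/-!
# An abelian variety of Weil type `(n, d)` with `End⁰ = K`: the `K`-eigenspaces `W`, `W̄` of `H¹(A(ℂ); ℂ)` are non-isomorphic `Lie Hg`-modules in duality and `W` carries no non-degenerate `Lie Hg`-invariant bilinear form (the WEIL LEG of the (3|3)-square, geometric reading; Moonen–Zarhin 1999, proof of Lemma (3.4))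

Family `hodge`, layer `Literature/AlgebraicGeometry/HodgeTheory`, namespace `Literature.AlgebraicGeometry.HodgeTheory`. THEOREMS ONLY
(no definition, no named fact, no `sorry`). Written for the cell `pub-hodgeav-hg6` (req-37 (A) Q2b; eng-4 g7, «W6»; lead g2
2026-08-29T00:51:12Z (3): «the standalone geometric lemma IsWeilType A φ 3 d ∧ End⁰(A) = K ⟹ Hom_{(Lie Hg)_ℂ}(W, W̄) = 0 … so that W3
applies and the (3|3) owner receives ‹no invariant form› as a one-line citation»; eng-4 g6's typed successor note
`hom_eigW_eigWbar_eq_zero_of_commute_hodgeLieC`). HONEST FRAMING: nothing here proves HC / `HC_AV` / `HC_CM` or the rung H2; this is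
unconditional Hodge theory of complex abelian varieties read on the tree's canonical rational Hodge structure `H¹(A(ℂ); ℚ)`
(`BettiUniverse.hodge exists_isReal_hodgeModel_holds _ 1`); no step towards a summit statement beyond its own content.

SETTING. `(A, φ)` of Weil type `(n, d)` (`HodgeTheory.IsWeilType A φ n d`: `dim A = 2n`, `φ ≫ φ = -d`, `d > 0`, `i√d` of multiplicity
`n` on `H^{1,0}`) with `End⁰(A) = K = ℚ(φ)` EXACTLY (`finrank_ℚ End⁰(A) = 2`, the special AND general members of TABLE X row 9, and
every Weil-type pair with `End⁰ = K`). On `H = H¹(A(ℂ); ℚ)` write `φ^*_ℚ = (bettiCohomology.map φ 1).hom`, `W = ker(φ^*_ℂ - i√d)`,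
`W̄ = ker(φ^*_ℂ + i√d)` (`⊆ ℂ ⊗_ℚ H¹(A(ℂ); ℚ)`), `𝔥 = Lie Hg(H¹A)` (`HodgeStructure.hodgeLie`), `𝔥_ℂ = hodgeLieC`.

CONTENT (every input a tree theorem BY NAME: Riemann's `End_Hdg(H¹) = End⁰(A)` in the form `exists_eq_smul_one_add_smul_bettiMapHom`
(R9), `bettiMapHom_mul_self`, `unop_bettiRep_mem_endAlg`, the multiplicity dictionary `finrank_eigenspace_inf_piece_oneZero_eq_eigenMultiplicity`,
W2 `IsWeilType.eigenMultiplicity_eq`, and the Hodge-structure-level Weil leg W4/W5 `CentralEigen.*`):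
* §1 `IsWeilType.bettiMapHom_facts_of_finrank_endAlgebra_eq_two` (the HS-level data: `φ^*_ℚ ∈ End_Hdg`, `(φ^*_ℚ)² = -d`,
  `End_Hdg(H¹) = ℚ + ℚφ^*_ℚ`, `(i√d)² = -d`), `IsWeilType.eigenspace_bettiMapHom_ne_bot` (`W ≠ 0`);
* §2 **`IsWeilType.eq_zero_of_forall_commute_hodgeLieC_of_mapsTo_eigenspace`** — an operator on `ℂ ⊗ H¹(A; ℚ)` commuting with `𝔥_ℂ`
  and carrying `W` into `W̄` kills `W` (the successor note's statement), and **`IsWeilType.linearMap_eigenspace_eq_zero`** —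
  `Hom_𝔥(W, W̄) = 0`: every `ℂ`-linear `f : W → W̄` intertwining the `X_ℂ`, `X ∈ 𝔥`, is zero (Moonen–Zarhin: `W`, `W̄` are
  «pairwise non-isomorphic» `hg_ℂ`-modules);
* §3 **`IsWeilType.not_exists_hodgeLie_invariant_form_on_eigenspace`** — there is NO bilinear form on `ℂ ⊗ H¹(A; ℚ)` which is
  left-non-degenerate on `W` and `𝔥`-invariant on `W`; with W2 (`IsWeilType.hodgeLie_eq_derived_of_centre_le`: `𝔥 = [𝔥, 𝔥]`) this is
  «no non-degenerate `[𝔊,𝔊]`-invariant form on `W`», i.e. branch 3 of the (3|3)-square's trichotomy is empty for every Weil-type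
  pair with `End⁰ = K` — NO displayed hypothesis (`HodgeTensorFacts` is the tree's discharged instance `hodgeTensorFacts_holds`,
  taken as an instance argument exactly as in W2).
NOT here: tracelessness / irreducibility of `𝔥_ℂ|_W` (irreducibility is the tree's `UnitaryTheta.eq_bot_or_eq_of_stable`), the
(3|3) core itself, the CM-field rows 11 / 13 (`End⁰ = E ⊋ K`: the HS-level theorem `CentralEigen.not_exists_invariant_form_on_eigenspace`
applies with `φ` central and Rosati-skew displayed), anything about Hodge classes.

## References

* [MoonenZarhin1999LowDim] B. Moonen, Yu. Zarhin, Math. Ann. 315 (1999) = arXiv:math/9901113, §3 proof of Lemma (3.4) (held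
  `paper:arxiv-math_9901113` p. 6: «irreducible `hg(X)_ℂ`-modules `U_1, …, U_e`, pairwise non-isomorphic»).
* [MoonenZarhin1998WeilClasses] B. Moonen, Yu. Zarhin, Crelle 496 (1998), §1 (Weil type: `Hg ⊆ U_K`, the special members).
* [vanGeemen1994HodgeAV] B. van Geemen, LNM 1594, 4.9 (Weil type `(n, d)`).
* [Gordon1997] B. B. Gordon, arXiv:alg-geom/9709030, §6 (proof of Thm. 6.3.3, p. 19).
* [FultonHarris1991] W. Fulton, J. Harris, GTM 129, §3.5 Lemma 3.35.
-/

noncomputable section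

open scoped TensorProduct
open CategoryTheory Module
open Literature.AlgebraicTopology.SingularHomology
open Literature.AlgebraicGeometry.Motives
open Literature.AlgebraicGeometry.Motives.HodgeStructure
open Literature.AlgebraicGeometry.ComplexMultiplication (bettiRep_of)

namespace Literature.AlgebraicGeometry.HodgeTheory

variable {A : AbelianVariety ℂ} {φ : A ⟶ A} {n d : ℕ}

/-! ### §1 The Hodge-structure-level data of a Weil-type pair with `End⁰ = K` -/

/-- **The HS-level data**: for `(A, φ)` of Weil type `(n, d)` with `finrank_ℚ End⁰(A) = 2`, the rational pull-back `φ^*_ℚ` on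
`H¹(A(ℂ); ℚ)` is a Hodge endomorphism with `(φ^*_ℚ)² = -d`, every Hodge endomorphism of `H¹` is `x + y φ^*_ℚ` (Riemann: `End_Hdg(H¹) =
End⁰(A) = K`, R9 `exists_eq_smul_one_add_smul_bettiMapHom`), and `(i√d)² = -d`. [cite: vanGeemen1994HodgeAV, 4.9 and Lemma 5.2]
[cite: MoonenZarhin1999LowDim, §2 (2.3)] -/
theorem IsWeilType.bettiMapHom_facts_of_finrank_endAlgebra_eq_two (h : IsWeilType A φ n d)
    (hE2 : Module.finrank ℚ A.endAlgebra = 2) :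
    (bettiCohomology.map φ.hom.hom.hom 1).hom ∈
        (BettiUniverse.hodge exists_isReal_hodgeModel_holds (AbelianVariety.isSmoothProjective_holds (A := A)) 1).endAlg ∧
      (bettiCohomology.map φ.hom.hom.hom 1).hom * (bettiCohomology.map φ.hom.hom.hom 1).hom = -((d : ℚ) • 1) ∧
      (∀ a ∈ (BettiUniverse.hodge exists_isReal_hodgeModel_holds (AbelianVariety.isSmoothProjective_holds (A := A)) 1).endAlg,
        ∃ x y : ℚ, a = x • 1 + y • (bettiCohomology.map φ.hom.hom.hom 1).hom) ∧
      (Complex.I * (Real.sqrt d : ℂ)) ^ 2 = -((d : ℚ) : ℂ) := by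
  have hφE : (bettiCohomology.map φ.hom.hom.hom 1).hom ∈
      (BettiUniverse.hodge exists_isReal_hodgeModel_holds (AbelianVariety.isSmoothProjective_holds (A := A)) 1).endAlg := by
    have h' := unop_bettiRep_mem_endAlg exists_isReal_hodgeModel_holds hodgePQ_independent_of_hodgeModel_holds
      (AbelianVariety.endAlgebra.of A φ)
    rwa [bettiRep_of, MulOpposite.unop_op] at h'
  have hA : 0 < A.dim := by rw [h.dim_eq]; have := h.pos; omega
  refine ⟨hφE, bettiMapHom_mul_self h.sq_eq,
    exists_eq_smul_one_add_smul_bettiMapHom exists_isReal_hodgeModel_holds hodgePQ_independent_of_hodgeModel_holds h.d_pos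
      h.sq_eq hE2 hA, ?_⟩
  rw [mul_pow, Complex.I_sq, ← Complex.ofReal_pow, Real.sq_sqrt (Nat.cast_nonneg d), Complex.ofReal_natCast, Rat.cast_natCast,
    neg_one_mul]

/-- **`W = ker(φ^*_ℂ - i√d) ≠ 0`** on `ℂ ⊗ H¹(A(ℂ); ℚ)` for a Weil-type pair: `dim (W ∩ H^{1,0}) = n > 0` (van Geemen 4.9, through the
tree's multiplicity dictionary `finrank_eigenspace_inf_piece_oneZero_eq_eigenMultiplicity` and W2 `IsWeilType.eigenMultiplicity_eq`).
[cite: vanGeemen1994HodgeAV, 4.9] -/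
theorem IsWeilType.eigenspace_bettiMapHom_ne_bot (h : IsWeilType A φ n d) :
    Module.End.eigenspace ((bettiCohomology.map φ.hom.hom.hom 1).hom.baseChange ℂ) (Complex.I * (Real.sqrt d : ℂ)) ≠ ⊥ := by
  intro hbot
  have hfin := finrank_eigenspace_inf_piece_oneZero_eq_eigenMultiplicity exists_isReal_hodgeModel_holds
    hodgePQ_independent_of_hodgeModel_holds φ (Complex.I * (Real.sqrt d : ℂ)) (A := A)
  rw [h.eigenMultiplicity_eq] at hfin
  have hle : Module.End.eigenspace ((bettiCohomology.map φ.hom.hom.hom 1).hom.baseChange ℂ) (Complex.I * (Real.sqrt d : ℂ)) ⊓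
      (BettiUniverse.hodge exists_isReal_hodgeModel_holds (AbelianVariety.isSmoothProjective_holds (A := A)) 1).piece 1 0 = ⊥ := by
    rw [hbot, bot_inf_eq]
  rw [hle, finrank_bot] at hfin
  exact h.pos.ne' hfin.symm  -- `0 = n` contradicts `0 < n`

/-! ### §2 `Hom_{Lie Hg}(W, W̄) = 0` -/

section LieForm

variable [HodgeTensorFacts.{0, 0}]

/-- **An operator on `ℂ ⊗ H¹(A(ℂ); ℚ)` commuting with `(Lie Hg)_ℂ` and carrying `W = ker(φ^*_ℂ - i√d)` into `W̄ = ker(φ^*_ℂ + i√d)` kills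
`W`** — for `(A, φ)` of Weil type `(n, d)` with `End⁰(A) = K` (`finrank_ℚ End⁰(A) = 2`). The statement of the cell's successor note
`hom_eigW_eigWbar_eq_zero_of_commute_hodgeLieC`; W4 `CentralEigen.eq_zero_of_forall_commute_hodgeLieC_of_mapsTo_eigenspace` with the
centrality of `φ^*_ℚ` from `End_Hdg(H¹) = ℚ + ℚφ^*_ℚ`. [cite: MoonenZarhin1999LowDim, §3 proof of Lemma (3.4)] [cite: vanGeemen1994HodgeAV, 4.9] -/
theorem IsWeilType.eq_zero_of_forall_commute_hodgeLieC_of_mapsTo_eigenspace (h : IsWeilType A φ n d)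
    (hE2 : Module.finrank ℚ A.endAlgebra = 2) {T : Module.End ℂ (ℂ ⊗[ℚ] bettiCohomology A.X 1)}
    (hT : ∀ Y ∈ (BettiUniverse.hodge exists_isReal_hodgeModel_holds (AbelianVariety.isSmoothProjective_holds (A := A)) 1).hodgeLieC,
      T * Y = Y * T)
    (hmaps : ∀ x ∈ Module.End.eigenspace ((bettiCohomology.map φ.hom.hom.hom 1).hom.baseChange ℂ) (Complex.I * (Real.sqrt d : ℂ)),
      T x ∈ Module.End.eigenspace ((bettiCohomology.map φ.hom.hom.hom 1).hom.baseChange ℂ) (-(Complex.I * (Real.sqrt d : ℂ))))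
    {x : ℂ ⊗[ℚ] bettiCohomology A.X 1}
    (hx : x ∈ Module.End.eigenspace ((bettiCohomology.map φ.hom.hom.hom 1).hom.baseChange ℂ) (Complex.I * (Real.sqrt d : ℂ))) :
    T x = 0 := by
  haveI : Module.Finite ℚ (bettiCohomology A.X 1) := finite_bettiCohomology_one A
  obtain ⟨-, -, hE, hμ⟩ := h.bettiMapHom_facts_of_finrank_endAlgebra_eq_two hE2
  obtain ⟨hμ0, -⟩ := UnitaryTheta.conj_eq_neg_of_sq (Nat.cast_pos.2 h.d_pos) hμ
  have hne : Complex.I * (Real.sqrt d : ℂ) ≠ -(Complex.I * (Real.sqrt d : ℂ)) := fun h' => hμ0 (by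
    have h2 : (2 : ℂ) * (Complex.I * (Real.sqrt d : ℂ)) = 0 := by
      rw [two_mul]; nth_rewrite 2 [h']; rw [add_neg_cancel]
    exact (mul_eq_zero.1 h2).resolve_left two_ne_zero)
  refine CentralEigen.eq_zero_of_forall_commute_hodgeLieC_of_mapsTo_eigenspace _ (fun a ha => ?_) hT hne hmaps hx
  obtain ⟨x, y, rfl⟩ := hE a ha
  rw [add_mul, mul_add, smul_mul_assoc, mul_smul_comm, one_mul, mul_one, smul_mul_assoc, mul_smul_comm]

/-- **`Hom_{Lie Hg(H¹A)}(W, W̄) = 0` for a Weil-type pair with `End⁰(A) = K`.** Every `ℂ`-linear map `f : W → W̄` between the two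
eigenspaces of `φ^*_ℂ` on `ℂ ⊗ H¹(A(ℂ); ℚ)` which intertwines the `X_ℂ`, `X ∈ Lie Hg(H¹A)` (stated proof-term free: `f w₁ = X_ℂ (f w)`
whenever `w₁ = X_ℂ w`), is ZERO — `W` and `W̄` are NON-ISOMORPHIC `Lie Hg`-modules (Moonen–Zarhin 1999, proof of Lemma (3.4), for
`D = F = K`: `V ⊗ ℂ = U_1 ⊕ U_2`, «pairwise non-isomorphic»). This is the hypothesis `hHom` of W3
(`Literature.Algebra.Lie.no_nondegenerate_invariant_form_of_forall_intertwiner_eq_zero`) on the abelian-variety side.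
[cite: MoonenZarhin1999LowDim, §3 proof of Lemma (3.4)] [cite: vanGeemen1994HodgeAV, 4.9] -/
theorem IsWeilType.linearMap_eigenspace_eq_zero (h : IsWeilType A φ n d) (hE2 : Module.finrank ℚ A.endAlgebra = 2)
    (f : Module.End.eigenspace ((bettiCohomology.map φ.hom.hom.hom 1).hom.baseChange ℂ) (Complex.I * (Real.sqrt d : ℂ)) →ₗ[ℂ]
      Module.End.eigenspace ((bettiCohomology.map φ.hom.hom.hom 1).hom.baseChange ℂ) (-(Complex.I * (Real.sqrt d : ℂ))))
    (hf : ∀ X ∈ (BettiUniverse.hodge exists_isReal_hodgeModel_holds (AbelianVariety.isSmoothProjective_holds (A := A)) 1).hodgeLie,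
      ∀ w w₁ : Module.End.eigenspace ((bettiCohomology.map φ.hom.hom.hom 1).hom.baseChange ℂ) (Complex.I * (Real.sqrt d : ℂ)),
        (w₁ : ℂ ⊗[ℚ] bettiCohomology A.X 1) = X.baseChange ℂ w →
          (f w₁ : ℂ ⊗[ℚ] bettiCohomology A.X 1) = X.baseChange ℂ (f w)) :
    f = 0 := by
  haveI : Module.Finite ℚ (bettiCohomology A.X 1) := finite_bettiCohomology_one A
  obtain ⟨hφE, hφ2, hE, hμ⟩ := h.bettiMapHom_facts_of_finrank_endAlgebra_eq_two hE2
  refine CentralEigen.linearMap_eigenspace_eq_zero_hodgeLie _ hφE (fun a ha => ?_) (Nat.cast_pos.2 h.d_pos) hφ2 hμ f hf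
  obtain ⟨x, y, rfl⟩ := hE a ha
  rw [add_mul, mul_add, smul_mul_assoc, mul_smul_comm, one_mul, mul_one, smul_mul_assoc, mul_smul_comm]

/-! ### §3 No non-degenerate `Lie Hg`-invariant bilinear form on `W` -/

/-- **No non-degenerate `Lie Hg(H¹A)`-invariant bilinear form on `W = ker(φ^*_ℂ - i√d)` — the WEIL LEG of the (3|3)-square for every
Weil-type pair `(A, φ)` with `End⁰(A) = K`, NO displayed hypothesis.** There is no bilinear form `b` on `ℂ ⊗ H¹(A(ℂ); ℚ)` which is
left-non-degenerate on `W` and invariant on `W` under the `X_ℂ`, `X ∈ Lie Hg(H¹A)`: `W ≠ 0` (§1), `W̄ ≅ W^*` equivariantly through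
any polarization of `H¹(A(ℂ); ℚ)` (`BettiUniverse.hodge_isPolarizable`; W5 `CentralEigen.exists_dualityEquiv`, `φ^*` being
Rosati-skew by positivity), and `Hom_{Lie Hg}(W, W̄) = 0` (§2) — W5
`CentralEigen.not_exists_invariant_form_on_eigenspace_of_endAlg_eq`. With W2 (`IsWeilType.hodgeLie_eq_derived_of_centre_le`:
`Lie Hg = [Lie Hg, Lie Hg]`) a `[𝔊,𝔊]`-invariant form on `W` is a `𝔊`-invariant one, so branch 3 of the (3|3) trichotomy («`W`
self-dual as a `[𝔊,𝔊]`-module») is EMPTY for the special Weil members of TABLE X row 9 (`Hg ⊊ SU_K`, `End⁰ = K`).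
[cite: MoonenZarhin1999LowDim, §3 proof of Lemma (3.4)] [cite: FultonHarris1991, §3.5 Lemma 3.35]
[cite: MoonenZarhin1998WeilClasses, §1 Lemma (1) and Criterion] [cite: vanGeemen1994HodgeAV, 4.9] -/
theorem IsWeilType.not_exists_hodgeLie_invariant_form_on_eigenspace (h : IsWeilType A φ n d)
    (hE2 : Module.finrank ℚ A.endAlgebra = 2) :
    ¬ ∃ b : LinearMap.BilinForm ℂ (ℂ ⊗[ℚ] bettiCohomology A.X 1),
        (∀ w ∈ Module.End.eigenspace ((bettiCohomology.map φ.hom.hom.hom 1).hom.baseChange ℂ) (Complex.I * (Real.sqrt d : ℂ)),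
            w ≠ 0 → ∃ w₂ ∈ Module.End.eigenspace ((bettiCohomology.map φ.hom.hom.hom 1).hom.baseChange ℂ)
              (Complex.I * (Real.sqrt d : ℂ)), b w w₂ ≠ 0) ∧
          ∀ X ∈ (BettiUniverse.hodge exists_isReal_hodgeModel_holds (AbelianVariety.isSmoothProjective_holds (A := A)) 1).hodgeLie,
            ∀ w ∈ Module.End.eigenspace ((bettiCohomology.map φ.hom.hom.hom 1).hom.baseChange ℂ) (Complex.I * (Real.sqrt d : ℂ)),
              ∀ w₂ ∈ Module.End.eigenspace ((bettiCohomology.map φ.hom.hom.hom 1).hom.baseChange ℂ) (Complex.I * (Real.sqrt d : ℂ)),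
                b (X.baseChange ℂ w) w₂ + b w (X.baseChange ℂ w₂) = 0 := by
  haveI : Module.Finite ℚ (bettiCohomology A.X 1) := finite_bettiCohomology_one A
  haveI : Nontrivial (bettiCohomology A.X 1) := by
    apply Module.nontrivial_of_finrank_pos (R := ℚ)
    rw [finrank_bettiCohomology_one A, h.dim_eq]
    have := h.pos
    omega
  obtain ⟨hφE, hφ2, hE, hμ⟩ := h.bettiMapHom_facts_of_finrank_endAlgebra_eq_two hE2
  obtain ⟨ψ⟩ := BettiUniverse.hodge_isPolarizable exists_isReal_hodgeModel_holds
    (AbelianVariety.isSmoothProjective_holds (A := A)) 1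
  set H := BettiUniverse.hodge exists_isReal_hodgeModel_holds (AbelianVariety.isSmoothProjective_holds (A := A)) 1 with hHdef
  obtain ⟨Θ, hΘ⟩ := exists_hodgeTheta H
  have hΘ𝔤 : Θ ∈ spanC H.hodgeLie := (hodgeLieC_eq_spanC H) ▸ H.mem_hodgeLieC_of_forall_piece hΘ
  exact CentralEigen.not_exists_invariant_form_on_eigenspace_of_endAlg_eq H ψ hφE (Nat.cast_pos.2 h.d_pos) hφ2 hE hμ H.hodgeLie
    hΘ hΘ𝔤 (fun X hX a => H.commute_of_mem_hodgeLie hX a) (fun X hX => form_apply_add_eq_zero_of_mem_hodgeLie ψ hX)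
    h.eigenspace_bettiMapHom_ne_bot

end LieForm

end Literature.AlgebraicGeometry.HodgeTheory

end
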